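import Mathlib
import HarnessLib
import Literature.NumberTheory.Automorphic.IsobaricRigidityRepData
import Literature.NumberTheory.Automorphic.GaloisActionPlaces
import Literature.NumberTheory.Automorphic.KimExteriorSquareGL4Lemmas
import Literature.NumberTheory.Automorphic.KimExteriorSquareGL4Proofs
import Literature.NumberTheory.Automorphic.TunnellOctahedralGlobalProofs
import Literature.NumberTheory.Automorphic.ArthurClozelCuspidalDescentGLOneHolds
import Literature.NumberTheory.Automorphic.AutomorphicTwistHecke
import Literature.NumberTheory.Automorphic.HeckeCharacterPairRigidity
import Literature.NumberTheory.Automorphic.RamakrishnanMultiplicityOneDihedral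
import Literature.NumberTheory.Automorphic.SelfdualGL3AdjointLiftProofs
import Literature.NumberTheory.GaloisRepresentations.HeckeCharacter

set_option linter.unusedVariables false
set_option linter.dupNamespace false

noncomputable section

namespace Summit.Langlands.Langlands.Theorems.InducedSquareAscentKleinCube

open scoped Classical NumberField
open Filter IsDedekindDomain NumberField
open Literature.NumberTheory.Automorphic
open Literature.NumberTheory.GaloisRepresentations (HeckeCharacter)

/-!
# The six local identities of the Klein-cube pole transfer (stub `localIdentities`)

Pure algebra for the line `Sketch-klein-cube-pole-transfer` of the crux `InducedSquareAscent`: six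
identities between finite products of reciprocal Rankin–Selberg Euler factors
`(satakePairPolynomial a b).eval y = ∏_{p ∈ a, q ∈ b} (1 - p q y)` attached to a `GL₄` parameter
`α` (four non-zero entries, `ω = ∏ α`), its exterior square `∧²α` and the induced halves `β₁, β₂`
(split: `∧²α = β₁ ⊎ β₂`) resp. `γ` (non-split: `∧²α = γ ⊎ (-γ)`, `β = γ²`, variable `x²`). They follow
from the multiset plethysms `α ⊗ α⁻¹ = {1} ⊎ ω⁻¹ · ∧²(∧²α)` (`∧² ∘ ∧² = Ad⁰ ⊗ det`),
`(∧²α)⁻¹ = ω⁻¹ · ∧²α` and `ωe · (α ⊗ α) ⊎ ω²e · (α⁻¹ ⊗ α⁻¹) = e · ∧³(∧²α) ⊎ 2 · (ωe · ∧²α)`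
(`∧³ ∘ ∧² = Sym² ⊗ det ⊕ Sym²ᵛ ⊗ det²`), proved for an explicit `α = {a, b, c, d}`.
-/

/-- `∏_{t ∈ m ⊎ m'} (1 - t y) = ∏_{t ∈ m} (1 - t y) · ∏_{t ∈ m'} (1 - t y)`. [folklore] -/
theorem kc_eval_add (m m' : Multiset ℂ) (y : ℂ) :
    (eulerPolynomial (m + m')).eval y = (eulerPolynomial m).eval y * (eulerPolynomial m').eval y := by
  rw [eulerPolynomial_add, Polynomial.eval_mul]

/-- The pairing `∏ (1 - t y) · ∏ (1 + t y) = ∏ (1 - t² y²)`. [folklore] -/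
theorem kc_eval_mul_eval_neg (m : Multiset ℂ) (y : ℂ) :
    (eulerPolynomial m).eval y * (eulerPolynomial (m.map fun t => -1 * t)).eval y =
      (eulerPolynomial (m.map fun t => t ^ 2)).eval (y ^ 2) := by
  induction m using Multiset.induction_on with
  | empty => simp
  | cons a m ih =>
    simp only [Multiset.map_cons, eulerPolynomial_cons, Polynomial.eval_mul, Polynomial.eval_sub,
      Polynomial.eval_one, Polynomial.eval_C, Polynomial.eval_X]
    rw [← ih]
    ring

/-- The pairing in the opposite order: `∏ (1 + t y) · ∏ (1 - t y) = ∏ (1 - t² y²)`. [folklore] -/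
theorem kc_eval_neg_mul_eval (m : Multiset ℂ) (y : ℂ) :
    (eulerPolynomial (m.map fun t => -1 * t)).eval y * (eulerPolynomial m).eval y =
      (eulerPolynomial (m.map fun t => t ^ 2)).eval (y ^ 2) := by
  rw [mul_comm, kc_eval_mul_eval_neg]

/-- Commuting a sign through a scaling, entrywise: `u · (-m) = -(u · m)`. [folklore] -/
theorem kc_map_neg_comm (u : ℂ) (m : Multiset ℂ) :
    (m.map fun t => -1 * t).map (fun t => u * t) = (m.map fun t => u * t).map (fun t => -1 * t) := by
  rw [Multiset.map_map, Multiset.map_map]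
  exact Multiset.map_congr rfl fun t _ => by simp only [Function.comp_apply]; ring

/-- `(u · m) ⊗ (v · (u · m)) = u²v · (m ⊗ m)`. [folklore] -/
theorem kc_T_map_map (u v : ℂ) (m : Multiset ℂ) :
    satakeTensor (m.map fun t => u * t) ((m.map fun t => u * t).map fun t => v * t) =
      (satakeTensor m m).map fun t => (u * (u * v)) * t := by
  rw [satakeTensor_map_mul_left, satakeTensor_map_mul_right, satakeTensor_map_mul_right,
    Multiset.map_map, Multiset.map_map]
  exact Multiset.map_congr rfl fun t _ => by simp only [Function.comp_apply]; ring

/-- `∧³(x ⊕ m) = ∧³m ⊎ x · ∧²m` on eigenvalue multisets (`∧³` as `powersetCard 3`). [folklore] -/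
theorem kc_wedgeThree_cons (x : ℂ) (m : Multiset ℂ) :
    ((x ::ₘ m).powersetCard 3).map Multiset.prod =
      (m.powersetCard 3).map Multiset.prod + (wedgeTwoParams m).map (fun t => x * t) := by
  rw [Multiset.powersetCard_cons, Multiset.map_add, wedgeTwoParams, Multiset.map_map,
    Multiset.map_map]
  congr 1
  exact Multiset.map_congr rfl fun t _ => by simp

/-- `∧³` of a one-element multiset is empty. [folklore] -/
theorem kc_wedgeThree_singleton (x : ℂ) :
    (({x} : Multiset ℂ).powersetCard 3).map Multiset.prod = 0 := by
  rw [Multiset.powersetCard_eq_empty 3 (by simp), Multiset.map_zero]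

/-- `∧³(a ⊕ b) = ∧³a ⊎ ∧³b ⊎ (∧²a ⊗ b ⊎ a ⊗ ∧²b)` on eigenvalue multisets. [folklore] -/
theorem kc_wedgeThree_add (a b : Multiset ℂ) :
    ((a + b).powersetCard 3).map Multiset.prod =
      (a.powersetCard 3).map Multiset.prod + (b.powersetCard 3).map Multiset.prod +
        (satakeTensor (wedgeTwoParams a) b + satakeTensor a (wedgeTwoParams b)) := by
  induction a using Multiset.induction_on with
  | empty => simp [satakeTensor]
  | cons x a ih =>
    rw [Multiset.cons_add, kc_wedgeThree_cons, kc_wedgeThree_cons, ih, wedgeTwoParams_add,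
      Multiset.map_add, Multiset.map_add, wedgeTwoParams_cons, satakeTensor_add_left,
      satakeTensor_map_mul_left, satakeTensor_cons_left]
    abel

/-- `∧³` of a three-element multiset is its determinant. [folklore] -/
theorem kc_wedgeThree_of_card_eq_three {m : Multiset ℂ} (h : Multiset.card m = 3) :
    (m.powersetCard 3).map Multiset.prod = {m.prod} := by
  have h' := Multiset.powersetCard_self m
  rw [h] at h'
  rw [h', Multiset.map_singleton]

/-- `u · ∧²m = (u · det m) · m⁻¹` for a three-element multiset `m` without zero entry. [folklore] -/
theorem kc_wedge3_map_mul {m : Multiset ℂ} (h : Multiset.card m = 3) (h0 : (0 : ℂ) ∉ m) (u : ℂ) :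
    (wedgeTwoParams m).map (fun t => u * t) =
      (m.map (fun t => t⁻¹)).map (fun t => (m.prod * u) * t) := by
  rw [wedgeTwoParams_eq_map_inv_of_card_eq_three h h0, Multiset.map_map]
  exact Multiset.map_congr rfl fun t _ => by simp only [Function.comp_apply]; ring

/-- `∧²(-m) = ∧²m`. [folklore] -/
theorem kc_wedgeTwoParams_map_neg (m : Multiset ℂ) :
    wedgeTwoParams (m.map fun t => -1 * t) = wedgeTwoParams m := by
  rw [wedgeTwoParams_map_mul]
  simp

/-- `∧²α` has no zero entry when `α` has none. [folklore] -/
theorem kc_zero_not_mem_wedge {α : Multiset ℂ} (h0 : ∀ a ∈ α, a ≠ 0) :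
    (0 : ℂ) ∉ wedgeTwoParams α := by
  intro h
  rw [wedgeTwoParams, Multiset.mem_map] at h
  obtain ⟨s, hs, hs0⟩ := h
  exact Multiset.prod_ne_zero
    (fun h' => h0 0 (Multiset.mem_of_le (Multiset.mem_powersetCard.1 hs).1 h') rfl) hs0

/-- `α⁻¹ = ω⁻¹ · α^c` for `α = {a, b, c, d}`, `ω = abcd`, `α^c = {bcd, acd, abd, abc}`. [folklore] -/
theorem kc_inv_four (a b c d : ℂ) (ha : a ≠ 0) (hb : b ≠ 0) (hc : c ≠ 0) (hd : d ≠ 0) :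
    (({a, b, c, d} : Multiset ℂ).map fun t => t⁻¹) =
      ({b * c * d, a * c * d, a * b * d, a * b * c} : Multiset ℂ).map
        fun t => (a * b * c * d)⁻¹ * t := by
  have h1 : (a * b * c * d)⁻¹ * (b * c * d) = a⁻¹ := by field_simp
  have h2 : (a * b * c * d)⁻¹ * (a * c * d) = b⁻¹ := by field_simp
  have h3 : (a * b * c * d)⁻¹ * (a * b * d) = c⁻¹ := by field_simp
  have h4 : (a * b * c * d)⁻¹ * (a * b * c) = d⁻¹ := by field_simp
  simp only [Multiset.insert_eq_cons, Multiset.map_cons, Multiset.map_singleton, h1, h2, h3, h4]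

/-- `α ⊗ α^c = {ω} ⊎ ∧²(∧²α)` for `α = {a, b, c, d}`: the plethysm `∧² ∘ ∧² = Ad⁰ ⊗ det` on `GL₄`,
cleared of denominators. [folklore] -/
theorem kc_tensor_compl_four (a b c d : ℂ) :
    satakeTensor ({a, b, c, d} : Multiset ℂ) {b * c * d, a * c * d, a * b * d, a * b * c} =
      (a * b * c * d) ::ₘ wedgeTwoParams (wedgeTwoParams {a, b, c, d}) := by
  simp only [Multiset.insert_eq_cons, wedgeTwoParams_cons, wedgeTwoParams_singleton,
    Multiset.map_cons, Multiset.map_singleton, satakeTensor_cons_left, satakeTensor_singleton_left,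
    add_zero, Multiset.cons_add, Multiset.singleton_add]
  ring_nf
  simp only [← Multiset.singleton_add]
  abel

/-- The Klein plethysm `∧³ ∘ ∧² = Sym² ⊗ det ⊕ Sym²ᵛ ⊗ det²` on `GL₄`, cleared of denominators, for
`α = {a, b, c, d}`: `ωe · (α ⊗ α) ⊎ e · (α^c ⊗ α^c) = e · ∧³(∧²α) ⊎ 2 · (ωe · ∧²α)`. [folklore] -/
theorem kc_klein_four (a b c d e : ℂ) :
    (satakeTensor ({a, b, c, d} : Multiset ℂ) {a, b, c, d}).map (fun t => (a * b * c * d * e) * t) +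
      (satakeTensor ({b * c * d, a * c * d, a * b * d, a * b * c} : Multiset ℂ)
        {b * c * d, a * c * d, a * b * d, a * b * c}).map (fun t => e * t) =
    (((wedgeTwoParams ({a, b, c, d} : Multiset ℂ)).powersetCard 3).map Multiset.prod).map
        (fun t => e * t) +
      ((wedgeTwoParams ({a, b, c, d} : Multiset ℂ)).map (fun t => (a * b * c * d * e) * t) +
        (wedgeTwoParams ({a, b, c, d} : Multiset ℂ)).map (fun t => (a * b * c * d * e) * t)) := by
  simp only [Multiset.insert_eq_cons, kc_wedgeThree_cons, kc_wedgeThree_singleton,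
    wedgeTwoParams_cons, wedgeTwoParams_singleton, Multiset.map_cons, Multiset.map_singleton,
    Multiset.map_zero, satakeTensor_cons_left, satakeTensor_singleton_left, add_zero, zero_add,
    Multiset.cons_add, Multiset.singleton_add]
  ring_nf
  simp only [← Multiset.singleton_add]
  abel

/-- `(∧²α)⁻¹ = ω⁻¹ · ∧²α` for a `GL₄` parameter `α` without zero entry (`ω = ∏ α`). [folklore] -/
theorem kc_wedge_map_inv {α : Multiset ℂ} (h4 : Multiset.card α = 4) (h0 : ∀ a ∈ α, a ≠ 0) :
    (wedgeTwoParams α).map (fun t => t⁻¹) = (wedgeTwoParams α).map (fun t => (α.prod)⁻¹ * t) := by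
  have h0' : (0 : ℂ) ∉ α := fun h => h0 0 h rfl
  conv_rhs => rw [← map_prod_mul_inv_wedgeTwoParams_of_card_eq_four h4 h0', Multiset.map_map]
  refine Multiset.map_congr rfl fun t _ => ?_
  rw [Function.comp_apply, ← mul_assoc, inv_mul_cancel₀ (Multiset.prod_ne_zero h0'), one_mul]

/-- `α ⊗ α⁻¹ = {1} ⊎ ω⁻¹ · ∧²(∧²α)` for a `GL₄` parameter `α` without zero entry: the plethysm
`V ⊗ V^∨ = 1 ⊕ Ad⁰ V`, `∧²(∧²V) = Ad⁰ V ⊗ det V` on `GL₄`. [folklore] -/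
theorem kc_tensor_inv {α : Multiset ℂ} (h4 : Multiset.card α = 4) (h0 : ∀ a ∈ α, a ≠ 0) :
    satakeTensor α (α.map fun t => t⁻¹) =
      {1} + (wedgeTwoParams (wedgeTwoParams α)).map (fun t => (α.prod)⁻¹ * t) := by
  obtain ⟨a, b, c, d, rfl⟩ := Multiset.card_eq_four.1 h4
  simp only [Multiset.insert_eq_cons, Multiset.mem_cons, Multiset.mem_singleton, forall_eq_or_imp,
    forall_eq] at h0
  obtain ⟨ha, hb, hc, hd⟩ := h0
  have hω : Multiset.prod {a, b, c, d} = a * b * c * d := by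
    simp only [Multiset.insert_eq_cons, Multiset.prod_cons, Multiset.prod_singleton, mul_assoc]
  have hω0 : a * b * c * d ≠ 0 := by simp [ha, hb, hc, hd]
  rw [hω, kc_inv_four a b c d ha hb hc hd, satakeTensor_map_mul_right, kc_tensor_compl_four,
    Multiset.map_cons, inv_mul_cancel₀ hω0, ← Multiset.singleton_add]

/-- The Klein plethysm for a `GL₄` parameter `α` without zero entry and a scalar `e`:
`ωe · (α ⊗ α) ⊎ ω²e · (α⁻¹ ⊗ α⁻¹) = e · ∧³(∧²α) ⊎ 2 · (ωe · ∧²α)`. [folklore] -/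
theorem kc_klein {α : Multiset ℂ} (h4 : Multiset.card α = 4) (h0 : ∀ a ∈ α, a ≠ 0) (e : ℂ) :
    satakeTensor α (α.map fun t => (α.prod * e) * t) +
      satakeTensor (α.map fun t => t⁻¹) ((α.map fun t => t⁻¹).map fun t => (α.prod ^ 2 * e) * t) =
    (((wedgeTwoParams α).powersetCard 3).map Multiset.prod).map (fun t => e * t) +
      ((wedgeTwoParams α).map (fun t => (α.prod * e) * t) +
        (wedgeTwoParams α).map (fun t => (α.prod * e) * t)) := by
  obtain ⟨a, b, c, d, rfl⟩ := Multiset.card_eq_four.1 h4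
  simp only [Multiset.insert_eq_cons, Multiset.mem_cons, Multiset.mem_singleton, forall_eq_or_imp,
    forall_eq] at h0
  obtain ⟨ha, hb, hc, hd⟩ := h0
  have hω : Multiset.prod {a, b, c, d} = a * b * c * d := by
    simp only [Multiset.insert_eq_cons, Multiset.prod_cons, Multiset.prod_singleton, mul_assoc]
  have he : (fun t => (a * b * c * d)⁻¹ * ((a * b * c * d)⁻¹ * ((a * b * c * d) ^ 2 * e)) * t) =
      fun t => e * t := by
    funext t
    field_simp
  rw [hω, kc_inv_four a b c d ha hb hc hd, kc_T_map_map, he, satakeTensor_map_mul_right]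
  exact kc_klein_four a b c d e

/-- **The six local identities** between reciprocal Rankin–Selberg Euler factors built from a `GL₄`
parameter `α` (four non-zero entries, `ω = ∏ α`), its exterior square `∧²α` and the induced halves
`β₁, β₂` (split: `∧²α = β₁ ⊎ β₂`) resp. `γ` (non-split: `∧²α = γ ⊎ (-γ)`, `β = γ²`): they encode the
`GL₄` plethysms `∧² ∘ ∧² = Ad⁰ ⊗ det` and `∧³ ∘ ∧² = Sym² ⊗ det ⊕ Sym²ᵛ ⊗ det²` together with
`(∧²α)⁻¹ = ω⁻¹ · ∧²α`. [folklore] -/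
theorem stub_localIdentities :
    (∀ (x : ℂ) (α β₁ β₂ : Multiset ℂ), Multiset.card α = 4 → (∀ a ∈ α, a ≠ 0) →
        Multiset.card β₁ = 3 → Multiset.card β₂ = 3 → wedgeTwoParams α = β₁ + β₂ →
        ((satakePairPolynomial α (α.map (fun a => a⁻¹))).eval x) ^ 2 =
          ((satakePairPolynomial ({1} : Multiset ℂ) ({1} : Multiset ℂ)).eval x) ^ 2 *
          (((satakePairPolynomial ((β₁.map (fun b => b⁻¹)).map (fun b => (β₁.prod * (α.prod)⁻¹) * b))
                ({1} : Multiset ℂ)).eval x) *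
            ((satakePairPolynomial ((β₂.map (fun b => b⁻¹)).map (fun b => (β₂.prod * (α.prod)⁻¹) * b))
                ({1} : Multiset ℂ)).eval x)) ^ 2 *
          (((satakePairPolynomial β₁ (β₂.map (fun b => (α.prod)⁻¹ * b))).eval x) *
            ((satakePairPolynomial β₂ (β₁.map (fun b => (α.prod)⁻¹ * b))).eval x))) ∧
    (∀ (x : ℂ) (α γ : Multiset ℂ), Multiset.card α = 4 → (∀ a ∈ α, a ≠ 0) →
        Multiset.card γ = 3 → wedgeTwoParams α = γ + γ.map (fun c => -c) →
        ((satakePairPolynomial α (α.map (fun a => a⁻¹))).eval x) *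
          ((satakePairPolynomial α ((α.map (fun a => a⁻¹)).map (fun a => (-1 : ℂ) * a))).eval x) =
          ((satakePairPolynomial ({1} : Multiset ℂ) ({1} : Multiset ℂ)).eval x) *
          ((satakePairPolynomial ({1} : Multiset ℂ) ({-1} : Multiset ℂ)).eval x) *
          ((satakePairPolynomial
              (((γ.map (fun c => c ^ 2)).map (fun b => b⁻¹)).map
                (fun b => ((γ.map (fun c => c ^ 2)).prod * ((α.prod) ^ 2)⁻¹) * b))
              ({1} : Multiset ℂ)).eval (x ^ 2)) ^ 2 *
          ((satakePairPolynomial (γ.map (fun c => c ^ 2))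
              ((γ.map (fun c => c ^ 2)).map (fun b => ((α.prod) ^ 2)⁻¹ * b))).eval (x ^ 2))) ∧
    (∀ (x : ℂ) (α β₁ β₂ : Multiset ℂ), Multiset.card α = 4 → (∀ a ∈ α, a ≠ 0) →
        Multiset.card β₁ = 3 → Multiset.card β₂ = 3 → wedgeTwoParams α = β₁ + β₂ →
        ((satakePairPolynomial β₁ (β₁.map (fun b => (α.prod)⁻¹ * b))).eval x) *
          ((satakePairPolynomial β₂ (β₂.map (fun b => (α.prod)⁻¹ * b))).eval x) *
          (((satakePairPolynomial β₁ (β₂.map (fun b => (α.prod)⁻¹ * b))).eval x) *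
            ((satakePairPolynomial β₂ (β₁.map (fun b => (α.prod)⁻¹ * b))).eval x)) =
        ((satakePairPolynomial β₁ (β₁.map (fun b => b⁻¹))).eval x) *
          ((satakePairPolynomial β₂ (β₂.map (fun b => b⁻¹))).eval x) *
          (((satakePairPolynomial β₁ (β₂.map (fun b => b⁻¹))).eval x) *
            ((satakePairPolynomial β₂ (β₁.map (fun b => b⁻¹))).eval x))) ∧
    (∀ (α γ : Multiset ℂ), Multiset.card α = 4 → (∀ a ∈ α, a ≠ 0) →
        Multiset.card γ = 3 → wedgeTwoParams α = γ + γ.map (fun c => -c) →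
        (γ.map (fun c => c ^ 2)).map (fun b => b⁻¹) =
          (γ.map (fun c => c ^ 2)).map (fun b => ((α.prod) ^ 2)⁻¹ * b)) ∧
    (∀ (x c : ℂ) (α β₁ β₂ : Multiset ℂ), Multiset.card α = 4 → (∀ a ∈ α, a ≠ 0) →
        Multiset.card β₁ = 3 → Multiset.card β₂ = 3 → wedgeTwoParams α = β₁ + β₂ →
        ((satakePairPolynomial α (α.map (fun a => (α.prod * c) * a))).eval x) *
          ((satakePairPolynomial (α.map (fun a => a⁻¹))
              ((α.map (fun a => a⁻¹)).map (fun a => (α.prod ^ 2 * c) * a))).eval x) =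
          (((satakePairPolynomial ({β₁.prod * c} : Multiset ℂ) ({1} : Multiset ℂ)).eval x) *
            ((satakePairPolynomial ({β₂.prod * c} : Multiset ℂ) ({1} : Multiset ℂ)).eval x)) *
          (((satakePairPolynomial (β₁.map (fun b => b⁻¹)) (β₂.map (fun b => (β₁.prod * c) * b))).eval x) *
            ((satakePairPolynomial (β₂.map (fun b => b⁻¹)) (β₁.map (fun b => (β₂.prod * c) * b))).eval x)) *
          (((satakePairPolynomial (β₁.map (fun b => (α.prod * c) * b)) ({1} : Multiset ℂ)).eval x) *
            ((satakePairPolynomial (β₂.map (fun b => (α.prod * c) * b)) ({1} : Multiset ℂ)).eval x)) ^ 2) ∧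
    (∀ (x c : ℂ) (α γ : Multiset ℂ), Multiset.card α = 4 → (∀ a ∈ α, a ≠ 0) →
        Multiset.card γ = 3 → wedgeTwoParams α = γ + γ.map (fun c => -c) →
        ((satakePairPolynomial α (α.map (fun a => (α.prod * c) * a))).eval x) *
          ((satakePairPolynomial (α.map (fun a => a⁻¹))
              ((α.map (fun a => a⁻¹)).map (fun a => (α.prod ^ 2 * c) * a))).eval x) =
          ((satakePairPolynomial ({(γ.map (fun c => c ^ 2)).prod * c ^ 2} : Multiset ℂ)
              ({1} : Multiset ℂ)).eval (x ^ 2)) *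
          ((satakePairPolynomial ((γ.map (fun c => c ^ 2)).map (fun b => b⁻¹))
              ((γ.map (fun c => c ^ 2)).map (fun b => ((γ.map (fun c => c ^ 2)).prod * c ^ 2) * b))).eval
              (x ^ 2)) *
          ((satakePairPolynomial ((γ.map (fun c => c ^ 2)).map (fun b => (α.prod ^ 2 * c ^ 2) * b))
              ({1} : Multiset ℂ)).eval (x ^ 2)) ^ 2) := by
  refine ⟨fun x α β₁ β₂ h4 h0 h₁ h₂ hW => ?_, fun x α γ h4 h0 h3 hW => ?_,
    fun x α β₁ β₂ h4 h0 _ _ hW => ?_, fun α γ h4 h0 _ hW => ?_,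
    fun x c α β₁ β₂ h4 h0 h₁ h₂ hW => ?_, fun x c α γ h4 h0 h3 hW => ?_⟩
  · -- (1) split, adjoint identity
    have hW0 := kc_zero_not_mem_wedge h0
    rw [hW, Multiset.mem_add, not_or] at hW0
    have hsym : satakePairPolynomial β₂ (β₁.map fun b => (α.prod)⁻¹ * b) =
        satakePairPolynomial β₁ (β₂.map fun b => (α.prod)⁻¹ * b) := by
      rw [satakePairPolynomial_eq_eulerPolynomial, satakePairPolynomial_eq_eulerPolynomial,
        satakeTensor_map_mul_right, satakeTensor_map_mul_right, satakeTensor_comm]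
    rw [hsym]
    simp only [satakePairPolynomial_eq_eulerPolynomial]
    rw [kc_tensor_inv h4 h0, hW, wedgeTwoParams_add, Multiset.map_add, Multiset.map_add,
      kc_wedge3_map_mul h₁ hW0.1, kc_wedge3_map_mul h₂ hW0.2, ← satakeTensor_map_mul_right]
    simp only [kc_eval_add, satakeTensor_singleton_one_right]
    ring
  · -- (2) non-split, adjoint identity
    have hW' : wedgeTwoParams α = γ + γ.map (fun t => -1 * t) := by
      simpa only [neg_one_mul] using hW
    have hW0 := kc_zero_not_mem_wedge h0
    rw [hW', Multiset.mem_add, not_or] at hW0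
    have hβ0 : (0 : ℂ) ∉ γ.map (fun t => t ^ 2) := fun h => by
      obtain ⟨s, hs, hs0⟩ := Multiset.mem_map.1 h
      exact hW0.1 ((pow_eq_zero_iff two_ne_zero).1 hs0 ▸ hs)
    have hβ3 : Multiset.card (γ.map (fun t => t ^ 2)) = 3 := by rw [Multiset.card_map, h3]
    have hM2 : (satakeTensor α (α.map fun a => a⁻¹)).map (fun t => t ^ 2) =
        {1} + (((wedgeTwoParams γ).map (fun t => t ^ 2)).map (fun t => (α.prod ^ 2)⁻¹ * t) +
          ((satakeTensor γ γ).map (fun t => t ^ 2)).map (fun t => (α.prod ^ 2)⁻¹ * t) +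
          ((wedgeTwoParams γ).map (fun t => t ^ 2)).map (fun t => (α.prod ^ 2)⁻¹ * t)) := by
      rw [kc_tensor_inv h4 h0, hW', wedgeTwoParams_add, kc_wedgeTwoParams_map_neg,
        satakeTensor_map_mul_right]
      simp only [Multiset.map_add, Multiset.map_singleton, Multiset.map_map, Function.comp_def,
        one_pow, mul_pow, inv_pow, neg_one_sq, one_mul]
    simp only [satakePairPolynomial_eq_eulerPolynomial]
    rw [satakeTensor_map_mul_right, kc_eval_mul_eval_neg, hM2, ← wedgeTwoParams_map_pow,
      kc_wedge3_map_mul hβ3 hβ0, ← satakeTensor_map_pow, ← satakeTensor_map_mul_right]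
    simp only [kc_eval_add, satakeTensor_singleton_one_right, satakeTensor_singleton_left,
      Multiset.map_singleton, eval_eulerPolynomial_singleton]
    ring
  · -- (3) split, `(∧²α)⁻¹ = ω⁻¹ · ∧²α` transported to `β₁ ⊎ β₂`
    have key : satakePairPolynomial (β₁ + β₂) ((β₁ + β₂).map (fun b => (α.prod)⁻¹ * b)) =
        satakePairPolynomial (β₁ + β₂) ((β₁ + β₂).map (fun b => b⁻¹)) := by
      rw [← hW, ← kc_wedge_map_inv h4 h0]
    rw [Multiset.map_add, Multiset.map_add, satakePairPolynomial_add_add,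
      satakePairPolynomial_add_add] at key
    have key' := congrArg (Polynomial.eval x) key
    simp only [Polynomial.eval_mul] at key'
    linear_combination key'
  · -- (4) non-split, `β⁻¹ = ω⁻² · β`
    have key := congrArg (Multiset.map fun t : ℂ => t ^ 2) (kc_wedge_map_inv h4 h0)
    rw [hW] at key
    simp only [Multiset.map_add, Multiset.map_map, Function.comp_def, inv_pow, neg_sq,
      mul_pow] at key
    simp only [Multiset.map_map, Function.comp_def]
    ext a
    have := congrArg (Multiset.count a) key
    simp only [Multiset.count_add] at this
    omega
  · -- (5) split, Klein cube
    have hW0 := kc_zero_not_mem_wedge h0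
    rw [hW, Multiset.mem_add, not_or] at hW0
    have e₁ : (satakeTensor (β₁.map fun b => b⁻¹) β₂).map (fun t => c * (β₁.prod * t)) =
        satakeTensor (β₁.map fun b => b⁻¹) (β₂.map fun b => (β₁.prod * c) * b) := by
      rw [satakeTensor_map_mul_right]
      exact Multiset.map_congr rfl fun t _ => by ring
    have e₂ : (satakeTensor (β₂.map fun b => b⁻¹) β₁).map (fun t => c * (β₂.prod * t)) =
        satakeTensor (β₂.map fun b => b⁻¹) (β₁.map fun b => (β₂.prod * c) * b) := by
      rw [satakeTensor_map_mul_right]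
      exact Multiset.map_congr rfl fun t _ => by ring
    simp only [satakePairPolynomial_eq_eulerPolynomial]
    rw [← kc_eval_add, kc_klein h4 h0 c, hW, kc_wedgeThree_add, kc_wedgeThree_of_card_eq_three h₁,
      kc_wedgeThree_of_card_eq_three h₂, wedgeTwoParams_eq_map_inv_of_card_eq_three h₁ hW0.1,
      wedgeTwoParams_eq_map_inv_of_card_eq_three h₂ hW0.2, satakeTensor_map_mul_left,
      satakeTensor_map_mul_right, satakeTensor_comm β₁ (β₂.map fun b => b⁻¹)]
    simp only [Multiset.map_add, Multiset.map_singleton, Multiset.map_map, Function.comp_def,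
      kc_eval_add, satakeTensor_singleton_one_right, eval_eulerPolynomial_singleton, e₁, e₂]
    ring
  · -- (6) non-split, Klein cube
    have hW' : wedgeTwoParams α = γ + γ.map (fun t => -1 * t) := by
      simpa only [neg_one_mul] using hW
    have hW0 := kc_zero_not_mem_wedge h0
    rw [hW', Multiset.mem_add, not_or] at hW0
    have h3' : Multiset.card (γ.map fun t => -1 * t) = 3 := by rw [Multiset.card_map, h3]
    have hγ' : (γ.map fun t => -1 * t).prod = -1 * γ.prod := by
      rw [Multiset.prod_map_mul, Multiset.map_const', Multiset.prod_replicate, h3, Multiset.map_id']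
      ring
    have hβp : (γ.map fun t => t ^ 2).prod = γ.prod ^ 2 := by
      rw [Multiset.prod_map_pow, Multiset.map_id']
    have hN2 : ((satakeTensor (wedgeTwoParams γ) γ).map (fun t => c * t)).map (fun t => t ^ 2) =
        satakeTensor ((γ.map fun t => t ^ 2).map fun b => b⁻¹)
          ((γ.map fun t => t ^ 2).map fun b => (γ.prod ^ 2 * c ^ 2) * b) := by
      have hinv : (γ.map fun t => t ^ 2).map (fun b => b⁻¹) =
          (γ.map fun t => t⁻¹).map (fun t => t ^ 2) := by
        rw [Multiset.map_map, Multiset.map_map]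
        exact Multiset.map_congr rfl fun t _ => by simp only [Function.comp_apply, inv_pow]
      rw [hinv, satakeTensor_map_mul_right, satakeTensor_map_pow,
        wedgeTwoParams_eq_map_inv_of_card_eq_three h3 hW0.1, satakeTensor_map_mul_left,
        Multiset.map_map, Multiset.map_map, Multiset.map_map]
      exact Multiset.map_congr rfl fun t _ => by simp only [Function.comp_apply]; ring
    have hG2 : (γ.map (fun t => (α.prod * c) * t)).map (fun t => t ^ 2) =
        (γ.map fun t => t ^ 2).map (fun b => (α.prod ^ 2 * c ^ 2) * b) := by
      rw [Multiset.map_map, Multiset.map_map]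
      exact Multiset.map_congr rfl fun t _ => by simp only [Function.comp_apply]; ring
    simp only [satakePairPolynomial_eq_eulerPolynomial]
    rw [← kc_eval_add, kc_klein h4 h0 c, hW', kc_wedgeThree_add, kc_wedgeThree_of_card_eq_three h3,
      kc_wedgeThree_of_card_eq_three h3', hγ', kc_wedgeTwoParams_map_neg,
      satakeTensor_map_mul_right, satakeTensor_comm γ (wedgeTwoParams γ)]
    simp only [Multiset.map_add, Multiset.map_singleton, kc_map_neg_comm, kc_eval_add,
      kc_eval_mul_eval_neg, kc_eval_neg_mul_eval, hN2, hG2, hβp, satakeTensor_singleton_one_right,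
      eval_eulerPolynomial_singleton]
    ring

end Summit.Langlands.Langlands.Theorems.InducedSquareAscentKleinCube

end
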